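import Summits.QuantumFields.YangMills.Theorems.BalabanUVNodesN14DressedTowerGuard
import Literature.MathematicalPhysics.QuantumFieldTheory.Balaban1983to89.Node00.Record13CoPHChi
import Summits.QuantumFields.YangMills.Theorems.BalabanUVNodesRateCarriersOfRecord13CoPHCmap

/-!
# DAG node N14 · NE1′ — THE KEYED GUARD `Ne1NondegenerateOn` AT A CENTRE-MAP-GENERIC («Cmap») STAGE-13 RATE READING, WITH THE RE-CENTRED («Ax») INSTANCE —
# op 5c supply row R10 for crux K3ᴬ `SpineGivenEndpointR13SepCoPHVAx` (stmt-QuantumFields-27247; plan g99 `D99-KAX/OP5C-SUPPLY-CENSUS-K3v8.md` §2 row 10)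

Cell `pub-ymgap`, seat `pub-ymgap-dag-n16-e` (R134 (a); dag-lead g40 HANDS-4a R10 — no n14 seat live), generation 30.  `--supports stmt-QuantumFields-27247 --as helper`
(count-neutral).  NEW basename beside the UNTOUCHED parent `Thm/BalabanUVNodesN14DressedTowerGuard` (dag-n14-w2 lineage, ns `YMDAG.N14.TowerGuard`); the
[Ax-3c]∕[Ax-3d] pattern of `Node00/Record13CoPHChi`: the parent's READING-BOUND declarations — `Ne1NondegenerateOn` (K3 v7 use-site `ne1NondegenerateOn_of_guardedReading`),
`ne1NondegenerateOn_anti`, `ne1NondegenerateOn_iff_of_ne1_eq`, `not_ne1NondegenerateOn_of_isEmpty` (use-site `not_guardedReading_of_ne1_isEmpty`) — re-issued VERBATIM over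
`(𝔯 : RateReading₁₃CoPHCmap N Χ)` with binder `(hP : θ.Provisos₁₃CoPHChi F N (Χ F θ.toStage13Params))`; the Ax instance `Ne1NondegenerateOnAx` is an `abbrev` at
`Χ := fun F => chiβOfRecord₁₃Ax F N`.  The parent's reading-free vocabulary (`Nondegenerate`, `BirthsNonempty`, `NotVacuum`, `RateCovers`, the junk doors on carriers, the
`OverBoxes` model) is cited by name unchanged.

HONEST FRAMING.  A definition re-issued over a parameter + kernel bookkeeping; no estimate; nothing of Bałaban asserted; NE1′ NOT printed for d = 4 and NOT proved; N14 NOT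
discharged; K3ᴬ OPEN (skeleton unregistered at filing); counts UNMOVED (typed 28∕28 · discharged 8∕27, A 8∕28); no `sorry`∕`instance`∕`notation`; standard axioms; one
finite four-torus at fixed ε — NOT ℝ⁴ ∕ infinite volume ∕ OS ∕ mass gap ∕ Clay.
-/

set_option autoImplicit false

noncomputable section

namespace YMDAG.N14.TowerGuard

open Literature.MathematicalPhysics.QuantumFieldTheory.Balaban1983to89
open Literature.MathematicalPhysics.QuantumFieldTheory.Balaban1983to89.T4Continuum
open YMDAG.UVSplit
open Node00 (Stage13Params Stage13HParams ChiSlot chiβOfRecord₁₃Ax)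

variable {N : ℕ} [NeZero N] {Χ : (F : T4Family) → Stage13Params F N → ChiSlot F N}

/-! ## §1 The keyed guard at a centre-map-generic reading -/

/-- **THE KEYED GUARD AT THE STAGE-13 TUPLES, centre-map-generic reading** [shape]: VERBATIM `Ne1NondegenerateOn` over `RateReading₁₃CoPHCmap N Χ` (binder
`hP : θ.Provisos₁₃CoPHChi F N (Χ F θ.toStage13Params)`). [folklore] -/
def Ne1NondegenerateOnCmap (𝔯 : RateReading₁₃CoPHCmap N Χ) (Rg : (F : T4Family) → Stage13HParams F N → Prop) : Prop :=
  ∀ (F : T4Family) (θ : Stage13HParams F N) (hP : θ.Provisos₁₃CoPHChi F N (Χ F θ.toStage13Params)), Rg F θ → θ.Admissible F N →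
    ∀ (g₀ : ℕ → ℝ) (os : List (ULoop F)), Nondegenerate (𝔯.ne1 F θ hP g₀ os)

/-- **The keyed guard at the RE-CENTRED reading** (instance `Χ := chiβOfRecord₁₃Ax`). [folklore] -/
abbrev Ne1NondegenerateOnAx (𝔯 : RateReading₁₃CoPHAx N) (Rg : (F : T4Family) → Stage13HParams F N → Prop) : Prop := Ne1NondegenerateOnCmap 𝔯 Rg

/-- The keyed guard is antitone in the regime. [folklore] -/
theorem ne1NondegenerateOnCmap_anti {𝔯 : RateReading₁₃CoPHCmap N Χ} {Rg Rg' : (F : T4Family) → Stage13HParams F N → Prop} (h : ∀ F θ, Rg F θ → Rg' F θ)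
    (hn : Ne1NondegenerateOnCmap 𝔯 Rg') : Ne1NondegenerateOnCmap 𝔯 Rg :=
  fun F θ hP hRg hθ g₀ os => hn F θ hP (h F θ hRg) hθ g₀ os

/-- The keyed guard reads `𝔯.ne1` only. [folklore] -/
theorem ne1NondegenerateOnCmap_iff_of_ne1_eq {𝔯 𝔯' : RateReading₁₃CoPHCmap N Χ} (Rg : (F : T4Family) → Stage13HParams F N → Prop)
    (h : ∀ (F : T4Family) (θ : Stage13HParams F N) (hP : θ.Provisos₁₃CoPHChi F N (Χ F θ.toStage13Params)) (g₀ : ℕ → ℝ) (os : List (ULoop F)),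
      𝔯.ne1 F θ hP g₀ os = 𝔯'.ne1 F θ hP g₀ os) :
    Ne1NondegenerateOnCmap 𝔯 Rg ↔ Ne1NondegenerateOnCmap 𝔯' Rg := by
  constructor
  · intro hn F θ hP hRg hθ g₀ os
    rw [← h F θ hP g₀ os]
    exact hn F θ hP hRg hθ g₀ os
  · intro hn F θ hP hRg hθ g₀ os
    rw [h F θ hP g₀ os]
    exact hn F θ hP hRg hθ g₀ os

/-! ## §2 The junk door the guard closes, at a centre-map-generic reading -/

/-- The keyed guard FAILS for a reading whose `ne1` has an empty index at ONE admissible tuple with χ-provisos in the regime. [folklore] -/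
theorem not_ne1NondegenerateOnCmap_of_isEmpty (𝔯 : RateReading₁₃CoPHCmap N Χ) (Rg : (F : T4Family) → Stage13HParams F N → Prop) {F : T4Family}
    (θ : Stage13HParams F N) (hP : θ.Provisos₁₃CoPHChi F N (Χ F θ.toStage13Params)) (hRg : Rg F θ) (hθ : θ.Admissible F N) (g₀ : ℕ → ℝ) (os : List (ULoop F))
    (h : IsEmpty (𝔯.ne1 F θ hP g₀ os).P) : ¬ Ne1NondegenerateOnCmap 𝔯 Rg :=
  fun hn => not_nondegenerate_of_isEmpty _ (hn F θ hP hRg hθ g₀ os)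

end YMDAG.N14.TowerGuard

end
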